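import Mathlib
import HarnessLib

/-!
# LatticeQCDFlow / Scaling — LOCAL DETERMINANT RATIOS: a finitely supported perturbation of an
# invertible matrix changes `log |det|` by a SUPPORT-SIZED amount, and two distant perturbations
# decouple at the rate of the inverse's off-diagonal decay (abstract engine)

HONEST FRAMING: exact (Metropolis-corrected) sampling algorithms for lattice gauge theory;
figures of merit are autocorrelation/cost numbers at stated couplings and volumes; no
continuum-physics claim.

THEORY-2.md §3.4 / §4 C5 / §5.4 `FermionDeterminantCost` (v4.4, theory seat GEN-25).  The change of
the fermionic effective action `S_q = -log det Q` under a LOCAL change of the gauge field is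
`ΔS_q = -log det (1 + Q⁻¹ ΔQ)` with `ΔQ` supported on the sites of the changed link
[cite: MontvayMunster1994, §7.4 (7.139)–(7.141)] — "the logarithm of the fermion determinant in the
effective boson action is non-local".  This file isolates the linear algebra that makes that
non-locality QUANTITATIVE for any invertible matrix `D` over `ℂ` on a finite index set and any
perturbation `E` supported in a block `s × s`:

* §1 Leibniz bounds: `‖det A‖ ≤ n!·xⁿ` for entries `≤ x` (`norm_det_le_of_entry_le`, PRIVATE: the same
  folklore bound is landed as `Summit.QuantumFields.BalabanUV.T4Continuum.SubstrateGaussianLettersBall.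
  norm_det_le_of_entry_le`, whose import chain is foreign to this venture; likewise the private helpers
  `norm_intCast_units_le_one` (= `Literature.NumberTheory.Automorphic.…`), `norm_prod_one_add_sub_one_le`,
  `one_add_pow_sub_one_le`; `norm_sum_le_card_mul_of_support` is public, used by the companion file), and
  `‖det (1 + M) - 1‖ ≤ (n! + n)·δ·(1 + δ)ⁿ⁻¹` for entries `‖M i j‖ ≤ δ` (`norm_det_one_add_sub_one_le`; the
  tree's `Literature.…Balaban1983to89.B13PkLocalTerms.norm_det_one_add_sub_one_le` is the row-sum form
  `∏ (1 + Σ_j ‖E i j‖) - 1`, a different statement).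
* §2 Compression (Sylvester): if the rows (or the columns) of `K` vanish outside `s`, then
  `det (1 + K) = det (1 + K|_{s×s})` (`det_one_add_eq_of_row_support`, `…_of_col_support`) — the
  determinant ratio of a supported perturbation is an `s.card × s.card` determinant, whatever the
  ambient dimension (the volume).
* §3 The two-perturbation identity
  `det (D + E₁ + E₂) · det D = det (D + E₁) · det (D + E₂) · det (1 - E₁ (D+E₁)⁻¹ E₂ (D+E₂)⁻¹)`
  (`det_add_add_mul_det`): the "connected" part of two perturbations factors through the CROSS
  block `(D + E₁)⁻¹|_{s₁ × s₂}` of an inverse.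
* §4 Assembly: `‖det (D + E)‖ ≤ ‖det D‖ · n!·(1 + n·a·e)ⁿ` with `n = s.card`, `a` a bound on the
  entries of `D⁻¹`, `e` on those of `E` (`norm_det_add_le`); the symmetric LOG-LIPSCHITZ form
  `|log ‖det (D+E)‖ - log ‖det D‖| ≤ log (n!·(1 + n·a·e)ⁿ)` (`abs_log_norm_det_add_sub_le`); and the
  DECOUPLING bound `‖det(D+E₁+E₂)·det D / (det(D+E₁)·det(D+E₂)) - 1‖ ≤ (n₁! + n₁)·δ·(1+δ)^{n₁-1}`
  with `δ ≥ n₁·n₂²·e²·a·b`, `b` a bound on the cross block `(D+E₁)⁻¹ k l`, `k ∈ s₁`, `l ∈ s₂`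
  (`norm_det_ratio_sub_one_le` — in the companion file `Scaling/LocalDeterminantDecoupling.lean`,
  split off at landing for the tree's 400-line limit; statements unchanged).  All constants depend
  on the support sizes and the entry bounds only — never on `Fintype.card ι`.

The lattice instance (Wilson–Dirac operator at heavy bare mass, where `a = 1/m` and the cross block
decays like `(4/(m+4))^{distance}` by the tree's `norm_inv_wilsonDirac_apply_le`) is
`Scaling/HeavyQuarkLocality.lean`.  NEW WORK of the cell (elementary linear algebra over Mathlib's
`Matrix.det_one_add_mul_comm`, `Matrix.det_apply'`); nothing is cited as a fact.
-/

noncomputable section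

namespace Summit.Ventures.LatticeQCDFlow.Scaling.LocalDet

open Matrix Finset

variable {ι : Type*} [Fintype ι] [DecidableEq ι]

/-! ### §1 Leibniz bounds -/

/-- The sign of a permutation, cast to `ℂ`, has norm at most one. [folklore] -/
private theorem norm_intCast_units_le_one (u : ℤˣ) : ‖((u : ℤ) : ℂ)‖ ≤ 1 := by
  rcases Int.units_eq_one_or u with h | h <;> simp [h]

/-- **Leibniz bound**: a matrix with entries of norm `≤ x` has `‖det‖ ≤ n!·xⁿ`. [folklore] -/
private theorem norm_det_le_of_entry_le (A : Matrix ι ι ℂ) {x : ℝ} (hx : ∀ i j, ‖A i j‖ ≤ x) :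
    ‖A.det‖ ≤ (Fintype.card ι).factorial * x ^ Fintype.card ι := by
  rw [Matrix.det_apply']
  refine (norm_sum_le _ _).trans ?_
  calc ∑ σ : Equiv.Perm ι, ‖(Equiv.Perm.sign σ : ℤ) * ∏ i, A (σ i) i‖
        ≤ ∑ _σ : Equiv.Perm ι, x ^ Fintype.card ι := by
          refine Finset.sum_le_sum fun σ _ => ?_
          rw [norm_mul, norm_prod]
          calc ‖((Equiv.Perm.sign σ : ℤ) : ℂ)‖ * ∏ i, ‖A (σ i) i‖ ≤ 1 * ∏ _i : ι, x :=
                mul_le_mul (norm_intCast_units_le_one _)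
                  (Finset.prod_le_prod (fun _ _ => norm_nonneg _) fun i _ => hx _ _)
                  (Finset.prod_nonneg fun _ _ => norm_nonneg _) zero_le_one
            _ = x ^ Fintype.card ι := by rw [one_mul, Finset.prod_const, Finset.card_univ]
    _ = (Fintype.card ι).factorial * x ^ Fintype.card ι := by
          rw [Finset.sum_const, Finset.card_univ, Fintype.card_perm, nsmul_eq_mul]

omit [Fintype ι] [DecidableEq ι] in
/-- `‖∏ (1 + f i) - 1‖ ≤ (1 + δ)^{#s} - 1` when `‖f i‖ ≤ δ`. [folklore] -/
private theorem norm_prod_one_add_sub_one_le (s : Finset ι) (f : ι → ℂ) {δ : ℝ} (hδ : 0 ≤ δ)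
    (h : ∀ i ∈ s, ‖f i‖ ≤ δ) : ‖∏ i ∈ s, (1 + f i) - 1‖ ≤ (1 + δ) ^ s.card - 1 := by
  induction s using Finset.cons_induction with
  | empty => simp
  | cons a s ha ih =>
    rw [Finset.prod_cons, Finset.card_cons]
    have hP : ‖∏ i ∈ s, (1 + f i)‖ ≤ (1 + δ) ^ s.card := by
      rw [norm_prod]
      calc ∏ i ∈ s, ‖1 + f i‖ ≤ ∏ _i ∈ s, (1 + δ) :=
            Finset.prod_le_prod (fun _ _ => norm_nonneg _) fun i hi =>
              (norm_add_le _ _).trans (by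
                rw [norm_one]; exact add_le_add le_rfl (h i (Finset.mem_cons_of_mem hi)))
        _ = (1 + δ) ^ s.card := Finset.prod_const _
    have ih' := ih fun i hi => h i (Finset.mem_cons_of_mem hi)
    calc ‖(1 + f a) * ∏ i ∈ s, (1 + f i) - 1‖
          = ‖(∏ i ∈ s, (1 + f i) - 1) + f a * ∏ i ∈ s, (1 + f i)‖ := by ring_nf
      _ ≤ ‖∏ i ∈ s, (1 + f i) - 1‖ + ‖f a‖ * ‖∏ i ∈ s, (1 + f i)‖ :=
          (norm_add_le _ _).trans (by rw [norm_mul])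
      _ ≤ ((1 + δ) ^ s.card - 1) + δ * (1 + δ) ^ s.card :=
          add_le_add ih' (mul_le_mul (h a (Finset.mem_cons_self _ _)) hP (norm_nonneg _) hδ)
      _ = (1 + δ) ^ (s.card + 1) - 1 := by ring

/-- Bernoulli-type bound `(1 + δ)ⁿ - 1 ≤ n·δ·(1 + δ)ⁿ⁻¹` for `δ ≥ 0`. [folklore] -/
private theorem one_add_pow_sub_one_le {δ : ℝ} (hδ : 0 ≤ δ) (n : ℕ) :
    (1 + δ) ^ n - 1 ≤ n * δ * (1 + δ) ^ (n - 1) := by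
  induction n with
  | zero => simp
  | succ k ih =>
    rcases Nat.eq_zero_or_pos k with rfl | hk
    · simp
    · have h1 : (1 + δ) ^ (k - 1) * (1 + δ) = (1 + δ) ^ k := by
        rw [← pow_succ, Nat.sub_add_cancel hk]
      have h2 : δ ≤ δ * (1 + δ) ^ k :=
        le_mul_of_one_le_right hδ (one_le_pow₀ (by linarith))
      have h3 := mul_le_mul_of_nonneg_right ih (by linarith : (0 : ℝ) ≤ 1 + δ)
      rw [pow_succ, Nat.succ_sub_one]
      push_cast
      calc (1 + δ) ^ k * (1 + δ) - 1 = ((1 + δ) ^ k - 1) * (1 + δ) + δ := by ring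
        _ ≤ (k : ℝ) * δ * (1 + δ) ^ (k - 1) * (1 + δ) + δ * (1 + δ) ^ k := add_le_add h3 h2
        _ = (k : ℝ) * δ * ((1 + δ) ^ (k - 1) * (1 + δ)) + δ * (1 + δ) ^ k := by ring
        _ = ((k : ℝ) + 1) * δ * (1 + δ) ^ k := by rw [h1]; ring

/-- **Determinant near the identity**: entries `‖M i j‖ ≤ δ` give
`‖det (1 + M) - 1‖ ≤ (n! + n)·δ·(1 + δ)ⁿ⁻¹` (identity permutation: `∏(1 + M i i) - 1`; every other
permutation has an off-diagonal factor `≤ δ`). [folklore] -/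
theorem norm_det_one_add_sub_one_le (M : Matrix ι ι ℂ) {δ : ℝ} (hδ : 0 ≤ δ)
    (h : ∀ i j, ‖M i j‖ ≤ δ) :
    ‖(1 + M).det - 1‖ ≤
      ((Fintype.card ι).factorial + Fintype.card ι) * δ * (1 + δ) ^ (Fintype.card ι - 1) := by
  set n := Fintype.card ι with hn
  rw [Matrix.det_apply', ← Finset.sum_erase_add _ _ (Finset.mem_univ (1 : Equiv.Perm ι))]
  have hdiag : ((Equiv.Perm.sign (1 : Equiv.Perm ι) : ℤ) : ℂ) *
      ∏ i, (1 + M) ((1 : Equiv.Perm ι) i) i = ∏ i, (1 + M i i) := by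
    simp [Matrix.add_apply]
  have hoff : ∀ σ ∈ (Finset.univ : Finset (Equiv.Perm ι)).erase 1,
      ‖((Equiv.Perm.sign σ : ℤ) : ℂ) * ∏ i, (1 + M) (σ i) i‖ ≤ δ * (1 + δ) ^ (n - 1) := by
    intro σ hσ
    obtain ⟨i₀, hi₀⟩ : ∃ i, σ i ≠ i := by
      by_contra hall
      exact (Finset.mem_erase.1 hσ).1 (Equiv.ext fun i => by simpa using not_exists.mp hall i)
    rw [norm_mul, norm_prod]
    calc ‖((Equiv.Perm.sign σ : ℤ) : ℂ)‖ * ∏ i, ‖(1 + M) (σ i) i‖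
          ≤ 1 * ∏ i, (if i = i₀ then δ else 1 + δ) := by
            refine mul_le_mul (norm_intCast_units_le_one _)
              (Finset.prod_le_prod (fun _ _ => norm_nonneg _) fun i _ => ?_)
              (Finset.prod_nonneg fun _ _ => norm_nonneg _) zero_le_one
            split_ifs with hi
            · subst hi
              rw [Matrix.add_apply, Matrix.one_apply_ne hi₀, zero_add]
              exact h _ _
            · rw [Matrix.add_apply]
              refine (norm_add_le _ _).trans (add_le_add ?_ (h _ _))
              rw [Matrix.one_apply]
              split_ifs <;> simp
      _ = δ * (1 + δ) ^ (n - 1) := by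
            rw [one_mul, ← Finset.mul_prod_erase _ _ (Finset.mem_univ i₀), if_pos rfl,
              Finset.prod_congr rfl fun i hi => if_neg (Finset.ne_of_mem_erase hi),
              Finset.prod_const, Finset.card_erase_of_mem (Finset.mem_univ _), Finset.card_univ]
  calc ‖(∑ σ ∈ (Finset.univ : Finset (Equiv.Perm ι)).erase 1,
            ((Equiv.Perm.sign σ : ℤ) : ℂ) * ∏ i, (1 + M) (σ i) i) +
          ((Equiv.Perm.sign (1 : Equiv.Perm ι) : ℤ) : ℂ) *
            ∏ i, (1 + M) ((1 : Equiv.Perm ι) i) i - 1‖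
        ≤ ‖∑ σ ∈ (Finset.univ : Finset (Equiv.Perm ι)).erase 1,
              ((Equiv.Perm.sign σ : ℤ) : ℂ) * ∏ i, (1 + M) (σ i) i‖ +
            ‖((Equiv.Perm.sign (1 : Equiv.Perm ι) : ℤ) : ℂ) *
              ∏ i, (1 + M) ((1 : Equiv.Perm ι) i) i - 1‖ := by
          rw [add_sub_assoc]; exact norm_add_le _ _
    _ ≤ (n.factorial : ℝ) * (δ * (1 + δ) ^ (n - 1)) + n * δ * (1 + δ) ^ (n - 1) := by
          refine add_le_add ?_ ?_
          · refine (norm_sum_le _ _).trans ((Finset.sum_le_sum hoff).trans ?_)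
            rw [Finset.sum_const, nsmul_eq_mul]
            refine mul_le_mul_of_nonneg_right ?_ (by positivity)
            exact_mod_cast (Finset.card_erase_le).trans
              (by rw [Finset.card_univ, Fintype.card_perm])
          · rw [hdiag]
            refine (norm_prod_one_add_sub_one_le Finset.univ (fun i => M i i) hδ
              fun i _ => h i i).trans ?_
            rw [Finset.card_univ]
            exact one_add_pow_sub_one_le hδ n
    _ = ((n.factorial : ℝ) + n) * δ * (1 + δ) ^ (n - 1) := by ring

/-! ### §2 Compression of `det (1 + K)` to the support of `K` -/

/-- **Sylvester compression, row form**: if every row of `K` outside `s` vanishes, then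
`det (1 + K) = det (1 + K|_{s × s})`. [folklore] -/
theorem det_one_add_eq_of_row_support (K : Matrix ι ι ℂ) (s : Finset ι)
    (hK : ∀ i j, i ∉ s → K i j = 0) :
    (1 + K).det = (1 + K.submatrix (Subtype.val : s → ι) Subtype.val).det := by
  let A : Matrix ι s ℂ := fun i j => if i = j.1 then 1 else 0
  let B : Matrix s ι ℂ := fun j k => K j.1 k
  have hAB : A * B = K := by
    ext i k
    simp only [Matrix.mul_apply, A, B, ite_mul, one_mul, zero_mul]
    by_cases hi : i ∈ s
    · rw [Finset.sum_eq_single ⟨i, hi⟩ (fun j _ hj => if_neg fun h => hj (Subtype.ext h.symm))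
        (fun h => absurd (Finset.mem_univ _) h), if_pos rfl]
    · rw [hK i k hi]
      exact Finset.sum_eq_zero fun j _ => if_neg fun h => hi (by rw [h]; exact j.2)
  have hBA : B * A = K.submatrix Subtype.val Subtype.val := by
    ext j j'
    simp only [Matrix.mul_apply, A, B, mul_ite, mul_one, mul_zero, Matrix.submatrix_apply]
    rw [Finset.sum_ite_eq' Finset.univ, if_pos (Finset.mem_univ _)]
  rw [← hBA, ← Matrix.det_one_add_mul_comm, hAB]

/-- **Sylvester compression, column form**: if every column of `K` outside `s` vanishes, then
`det (1 + K) = det (1 + K|_{s × s})`. [folklore] -/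
theorem det_one_add_eq_of_col_support (K : Matrix ι ι ℂ) (s : Finset ι)
    (hK : ∀ i j, j ∉ s → K i j = 0) :
    (1 + K).det = (1 + K.submatrix (Subtype.val : s → ι) Subtype.val).det := by
  rw [← Matrix.det_transpose, Matrix.transpose_add, Matrix.transpose_one,
    det_one_add_eq_of_row_support Kᵀ s (fun i j hi => hK j i hi), ← Matrix.det_transpose,
    Matrix.transpose_add, Matrix.transpose_one, Matrix.transpose_submatrix, Matrix.transpose_transpose]

/-! ### §3 The two-perturbation identity -/

/-- **Two supported perturbations**: for `D + E₁`, `D + E₂` invertible,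
`det (D + E₁ + E₂) · det D = det (D + E₁) · det (D + E₂) · det (1 - E₁ (D+E₁)⁻¹ E₂ (D+E₂)⁻¹)`
(from `(D + E₁) - E₂ (D+E₂)⁻¹ E₁ = D (D+E₂)⁻¹ (D + E₁ + E₂)` and Sylvester's identity). [folklore] -/
theorem det_add_add_mul_det (D E₁ E₂ : Matrix ι ι ℂ) (h₁ : IsUnit (D + E₁).det)
    (h₂ : IsUnit (D + E₂).det) :
    (D + E₁ + E₂).det * D.det =
      (D + E₁).det * (D + E₂).det * (1 - E₁ * (D + E₁)⁻¹ * E₂ * (D + E₂)⁻¹).det := by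
  set D₁ := D + E₁ with hD₁
  set D₂ := D + E₂ with hD₂
  have hX : E₁ * D₁⁻¹ * E₂ * D₂⁻¹ = E₁ * (D₁⁻¹ * E₂ * D₂⁻¹) := by
    simp only [Matrix.mul_assoc]
  have hsyl : (1 - E₁ * D₁⁻¹ * E₂ * D₂⁻¹).det = (1 - D₁⁻¹ * E₂ * D₂⁻¹ * E₁).det := by
    rw [hX, Matrix.det_one_sub_mul_comm]
  -- `D₁ (1 - D₁⁻¹ E₂ D₂⁻¹ E₁) = D₁ - E₂ D₂⁻¹ E₁ = D D₂⁻¹ (D + E₁ + E₂)`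
  have hkey : D₁ * (1 - D₁⁻¹ * E₂ * D₂⁻¹ * E₁) = D * D₂⁻¹ * (D + E₁ + E₂) := by
    have e1 : D₁ * (1 - D₁⁻¹ * E₂ * D₂⁻¹ * E₁) = D₁ - E₂ * D₂⁻¹ * E₁ := by
      rw [Matrix.mul_sub, Matrix.mul_one, Matrix.mul_assoc D₁⁻¹, Matrix.mul_assoc D₁⁻¹,
        Matrix.mul_nonsing_inv_cancel_left _ _ h₁, Matrix.mul_assoc]
    have e2 : E₂ * D₂⁻¹ = 1 - D * D₂⁻¹ := by
      rw [show E₂ = D₂ - D by rw [hD₂]; abel, Matrix.sub_mul, Matrix.mul_nonsing_inv _ h₂]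
    have e3 : D * D₂⁻¹ * (D + E₁ + E₂) = D + D * D₂⁻¹ * E₁ := by
      rw [show D + E₁ + E₂ = D₂ + E₁ by rw [hD₂]; abel, Matrix.mul_add, Matrix.mul_assoc,
        Matrix.nonsing_inv_mul _ h₂, Matrix.mul_one]
    rw [e1, e2, e3, Matrix.sub_mul, Matrix.one_mul, hD₁]
    abel
  have hdet := congrArg Matrix.det hkey
  rw [Matrix.det_mul, Matrix.det_mul, Matrix.det_mul] at hdet
  -- multiply by `det D₂` and use `det D₂⁻¹ · det D₂ = 1`
  have hunit : D₂⁻¹.det * D₂.det = 1 := Matrix.det_nonsing_inv_mul_det _ h₂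
  calc (D + E₁ + E₂).det * D.det = D.det * D₂⁻¹.det * (D + E₁ + E₂).det * D₂.det := by
        rw [show D.det * D₂⁻¹.det * (D + E₁ + E₂).det * D₂.det =
            (D + E₁ + E₂).det * D.det * (D₂⁻¹.det * D₂.det) by ring, hunit, mul_one]
    _ = D₁.det * (1 - D₁⁻¹ * E₂ * D₂⁻¹ * E₁).det * D₂.det := by rw [← hdet]
    _ = D₁.det * D₂.det * (1 - E₁ * D₁⁻¹ * E₂ * D₂⁻¹).det := by rw [hsyl]; ring

/-! ### §4 Entry bounds and the assembled inequalities -/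

omit [DecidableEq ι] in
/-- A sum whose terms vanish outside `s` and have norm `≤ b` on `s` has norm `≤ #s · b`. [folklore] -/
theorem norm_sum_le_card_mul_of_support (s : Finset ι) {f : ι → ℂ} {b : ℝ}
    (hf : ∀ l, l ∉ s → f l = 0) (hb : ∀ l ∈ s, ‖f l‖ ≤ b) : ‖∑ l, f l‖ ≤ s.card * b := by
  rw [← Finset.sum_subset (Finset.subset_univ s) fun l _ hl => hf l hl]
  refine (norm_sum_le _ _).trans ?_
  calc ∑ l ∈ s, ‖f l‖ ≤ ∑ _l ∈ s, b := Finset.sum_le_sum hb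
    _ = s.card * b := by rw [Finset.sum_const, nsmul_eq_mul]

/-- **Supported perturbation, one-sided**: `E` supported in `s × s` with entries `≤ e`, `D⁻¹` with
entries `≤ a` ⇒ `‖det (D + E)‖ ≤ ‖det D‖ · n!·(1 + n·a·e)ⁿ`, `n = #s`, independently of the ambient
dimension. [folklore] -/
theorem norm_det_add_le (D E : Matrix ι ι ℂ) (s : Finset ι) {a e : ℝ} (ha0 : 0 ≤ a)
    (hD : IsUnit D.det) (hE : ∀ i j, E i j ≠ 0 → i ∈ s ∧ j ∈ s)
    (ha : ∀ i j, ‖D⁻¹ i j‖ ≤ a) (he : ∀ i j, ‖E i j‖ ≤ e) :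
    ‖(D + E).det‖ ≤ ‖D.det‖ * (s.card.factorial * (1 + s.card * (a * e)) ^ s.card) := by
  have hDE : D + E = D * (1 + D⁻¹ * E) := by
    rw [Matrix.mul_add, Matrix.mul_one, Matrix.mul_nonsing_inv_cancel_left _ _ hD]
  rw [hDE, Matrix.det_mul, norm_mul]
  refine mul_le_mul_of_nonneg_left ?_ (norm_nonneg _)
  have hcol : ∀ i j, j ∉ s → (D⁻¹ * E) i j = 0 := fun i j hj => by
    rw [Matrix.mul_apply]
    refine Finset.sum_eq_zero fun l _ => ?_
    by_cases h0 : E l j = 0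
    · rw [h0, mul_zero]
    · exact absurd (hE l j h0).2 hj
  rw [det_one_add_eq_of_col_support _ s hcol]
  have hent : ∀ i j : s,
      ‖(1 + (D⁻¹ * E).submatrix Subtype.val Subtype.val) i j‖ ≤ 1 + s.card * (a * e) := by
    intro i j
    rw [Matrix.add_apply, Matrix.submatrix_apply]
    refine (norm_add_le _ _).trans (add_le_add ?_ ?_)
    · rw [Matrix.one_apply]
      split_ifs <;> simp
    · rw [Matrix.mul_apply]
      refine norm_sum_le_card_mul_of_support s (fun l hl => ?_) fun l _ => ?_
      · by_cases h0 : E l j = 0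
        · rw [h0, mul_zero]
        · exact absurd (hE l j h0).1 hl
      · rw [norm_mul]
        exact mul_le_mul (ha _ _) (he _ _) (norm_nonneg _) ha0
  refine (norm_det_le_of_entry_le _ hent).trans_eq ?_
  rw [Fintype.card_coe]

/-- The constant `n!·(1 + n·c)ⁿ` is at least one. [folklore] -/
theorem one_le_factorial_mul_pow (n : ℕ) {c : ℝ} (hc : 0 ≤ c) :
    (1 : ℝ) ≤ n.factorial * (1 + n * c) ^ n := by
  have h1 : (1 : ℝ) ≤ n.factorial := by exact_mod_cast Nat.one_le_iff_ne_zero.2 (Nat.factorial_ne_zero n)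
  have h2 : (1 : ℝ) ≤ (1 + n * c) ^ n := one_le_pow₀ (by nlinarith [n.cast_nonneg (α := ℝ)])
  nlinarith

/-- The constant `n!·(1 + n·c)ⁿ` is monotone in the support size `n`. [folklore] -/
theorem factorial_mul_pow_mono {n n' : ℕ} (hn : n ≤ n') {c : ℝ} (hc : 0 ≤ c) :
    (n.factorial : ℝ) * (1 + n * c) ^ n ≤ n'.factorial * (1 + n' * c) ^ n' := by
  have h1 : (n.factorial : ℝ) ≤ n'.factorial := by exact_mod_cast Nat.factorial_le hn
  have hb : (1 : ℝ) ≤ 1 + n' * c := by nlinarith [n'.cast_nonneg (α := ℝ)]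
  have h2 : (1 + (n : ℝ) * c) ^ n ≤ (1 + n' * c) ^ n' :=
    (pow_le_pow_left₀ (by nlinarith [n.cast_nonneg (α := ℝ)])
      (by gcongr) n).trans (pow_le_pow_right₀ hb hn)
  exact mul_le_mul h1 h2 (by positivity) (by positivity)

/-- **Supported perturbation, LOG-LIPSCHITZ form**: if both `D` and `D + E` are invertible with
inverse entries `≤ a`, and `E` is supported in `s × s` with entries `≤ e`, then
`|log ‖det (D + E)‖ - log ‖det D‖| ≤ log (n!·(1 + n·a·e)ⁿ)`, `n = #s`. [folklore] -/
theorem abs_log_norm_det_add_sub_le (D E : Matrix ι ι ℂ) (s : Finset ι) {a e : ℝ} (ha0 : 0 ≤ a)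
    (he0 : 0 ≤ e) (hD : IsUnit D.det) (hD' : IsUnit (D + E).det)
    (hE : ∀ i j, E i j ≠ 0 → i ∈ s ∧ j ∈ s) (ha : ∀ i j, ‖D⁻¹ i j‖ ≤ a)
    (ha' : ∀ i j, ‖(D + E)⁻¹ i j‖ ≤ a) (he : ∀ i j, ‖E i j‖ ≤ e) :
    |Real.log ‖(D + E).det‖ - Real.log ‖D.det‖| ≤
      Real.log (s.card.factorial * (1 + s.card * (a * e)) ^ s.card) := by
  set C : ℝ := s.card.factorial * (1 + s.card * (a * e)) ^ s.card with hC
  have hC1 : 1 ≤ C := one_le_factorial_mul_pow _ (mul_nonneg ha0 he0)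
  have h1 : ‖(D + E).det‖ ≤ ‖D.det‖ * C := norm_det_add_le D E s ha0 hD hE ha he
  have h2 : ‖D.det‖ ≤ ‖(D + E).det‖ * C := by
    have hE' : ∀ i j, (-E) i j ≠ 0 → i ∈ s ∧ j ∈ s := fun i j h =>
      hE i j (by simpa using h)
    have he' : ∀ i j, ‖(-E) i j‖ ≤ e := fun i j => by rw [Matrix.neg_apply, norm_neg]; exact he i j
    have := norm_det_add_le (D + E) (-E) s ha0 hD' hE' ha' he'
    rwa [add_neg_cancel_right] at this
  have hp : 0 < ‖D.det‖ := norm_pos_iff.2 hD.ne_zero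
  have hp' : 0 < ‖(D + E).det‖ := norm_pos_iff.2 hD'.ne_zero
  have hl1 := Real.log_le_log hp' h1
  have hl2 := Real.log_le_log hp h2
  rw [Real.log_mul hp.ne' (by positivity)] at hl1
  rw [Real.log_mul hp'.ne' (by positivity)] at hl2
  rw [abs_sub_le_iff]
  constructor <;> linarith

end Summit.Ventures.LatticeQCDFlow.Scaling.LocalDet

end
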